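/-
Copyright (c) 2026 the pub-hodgecm-mathlib formalisation cell (harness21).  Prover seat hodgecm-mathlib-K2E1-p13 (g0), Track B ∕ K2-LIT, h413 = `stmt-HodgeConjecture-24833`,
line `K2_E1_TraceFormulaBeta`, campaign «R8₂-sph EXHAUSTION», (69) f3-sph FILE C = (GR) of K2E3-p12 (g7)'s census memo `K2/K2E3-p12/g7/CENSUS-f3sph-…md` §6 (dealer K2E1-plan (g6) (88)):
integrating a RADIAL function over an idele class domain — `∫_{𝓕} g(‖x‖) dν = V·∫_0^∞ g(r) dr∕r` (Tate's `d𝔞 = d𝔟·dt∕t`), Bochner and `ℝ≥0∞` forms, number-field generic.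
-/
import Literature.NumberTheory.Automorphic.IdeleClassIntegration      -- ★ `logNorm`, `idelicCovolume`, `integral_comp_logNorm_eq`, `lintegral_comp_logNorm_eq`, `IsIdeleClassDomain`
import Mathlib.MeasureTheory.Function.JacobianOneDim                  -- Mathlib change of variables `∫_{f '' s} g = ∫_s |f′|•(g∘f)` in dimension one
import Mathlib.Analysis.SpecialFunctions.Pow.Complex
import HarnessLib

/-!
# R8₂-sph (69) f3-sph FILE C — `K2E1IdeleClassRadialIntegralCM`: `∫_{𝓕} g(‖x‖) dν(x) = V·∫_0^∞ g(r) r⁻¹ dr` over an idele class domain, and the `‖x‖⁻¹`-weighted form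
# `∫_{𝓕} ‖x‖⁻¹·φ(‖x‖) dν = V·∫_0^∞ φ(r)·r^{−2} dr` in the currency of ★ (δ)₂ `K2E1EisensteinPairingUnfoldedWeightU2` (right side) and ★ A's Parseval I (weight `r^{−2}`)

Track B ∕ K2-LIT, crux h413 = `stmt-HodgeConjecture-24833`, route of record `HCCMUnconditional`; cell `hodgecm-mathlib`, squad K2, ENGINE E1.  THEOREMS ONLY (no `def`, no `instance`,
no `notation`, no `sorry`; default heartbeats); lane `--supports stmt-HodgeConjecture-24833 --as helper` (count-neutral).  Number-field generic (`K`); `‖x‖ := IdeleClassGroup.ideleNorm K x`.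
THE MATHEMATICS ([CasselsFrohlichANT1967, Ch. XV (Tate) §4.3–4.4, `d𝔞 = d𝔟·dt∕t`]; [MoeglinWaldspurger1995, II.2.1]).  ★ Literature `integral_comp_logNorm_eq` pushes a left-invariant measure `ν`
(finite on compacta) restricted to a fundamental domain `𝓕` of `K^×` forward along `u = log ‖x‖` to `V·du` on `ℝ` (`V = idelicCovolume K ν`, Tate's `κ`-type constant; by ★ Tate's formula
`∫_{𝓕 ∩ {‖x‖≤1}} ‖x‖ dν = V`, it is the idelic bracket `κ` of ★ (R6k)₂).  The substitution `r = e^u` (Mathlib `integral_image_eq_integral_abs_deriv_smul` in dimension one, `|d e^u∕du| = e^u`)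
turns `∫_ℝ g(e^u) du` into `∫_0^∞ g(r) r⁻¹ dr` (§1), whence (§2) `∫_{𝓕} g(‖x‖) dν = V·∫_0^∞ r⁻¹•g(r) dr` and (§3, HEAD) for the `‖x‖⁻¹`-weighted radial integrand of ★ (δ)₂'s right side
`∫_{𝓕} ‖x‖⁻¹ • φ(‖x‖) dν = V·∫_0^∞ φ(r)·r^{−2} dr` — the weight `r^{−2}` of ★ A `setIntegral_mul_conj_mul_cpow_eq` (Parseval I); the `ℝ≥0∞` twins serve (δ)₂'s finiteness clause on `Φm`.
* §1 `integral_comp_exp_eq_setIntegral_inv_smul`, `lintegral_comp_exp_eq_setLIntegral` (pure real analysis, any normed `E`).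
* §2 `setIntegral_comp_ideleNorm_eq`, `setLIntegral_comp_ideleNorm_eq` (any fundamental domain of `K^×`).
* §3 HEAD **`setIntegral_inv_ideleNorm_smul_comp_eq`** (ℂ-valued, (δ)₂∕Parseval-I currency, `IsIdeleClassDomain`), `setLIntegral_inv_ideleNorm_mul_comp_eq` (ℝ≥0∞ twin).
HONEST LABEL: HC_CM is proved only modulo the 7 printed citations (2 remaining named inputs: hLiu418 = `stmt-HodgeConjecture-24832`, h413 = `stmt-HodgeConjecture-24833`) until rung 0
closes; this file asserts no named fact, closes no socket; count-neutral; letter-free.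

## References
* [CasselsFrohlichANT1967] J. W. S. Cassels, A. Fröhlich (eds.), *Algebraic Number Theory* (1967), Ch. XV (J. Tate, *Fourier analysis in number fields and Hecke's zeta-functions*), §4.3–4.4.
* [MoeglinWaldspurger1995] C. Mœglin, J.-L. Waldspurger, *Spectral decomposition and Eisenstein series* (1995), II.2.1.
-/

set_option autoImplicit false
set_option linter.dupNamespace false  -- the mandated namespace repeats the summit's segment (`HodgeConjecture.HodgeConjecture`)

noncomputable section

open MeasureTheory Measure Set Filter Topology NumberField
open scoped ENNReal NNReal
open Literature.NumberTheory Literature.NumberTheory.Automorphic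

namespace Summit.HodgeConjecture.HodgeConjecture.Cruxes.H413.K2E1IdeleClassRadialIntegralCM

/-! ## §1 The substitution `r = e^u`: `∫_ℝ g(e^u) du = ∫_0^∞ g(r) r⁻¹ dr` -/

section Real

variable {E : Type*} [NormedAddCommGroup E] [NormedSpace ℝ E]

/-- **`∫_ℝ g(e^u) du = ∫_0^∞ r⁻¹ • g(r) dr`** (Bochner; Mathlib `integral_image_eq_integral_abs_deriv_smul` for `exp : ℝ ≃ (0,∞)`, `|exp′ u| • (e^u)⁻¹ • g(e^u) = g(e^u)`).  No integrability
hypothesis: both sides are Bochner integrals of functions that correspond under the measure-preserving change of variables. [cite: CasselsFrohlichANT1967, Ch. XV §4.3] -/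
theorem integral_comp_exp_eq_setIntegral_inv_smul (g : ℝ → E) : ∫ u, g (Real.exp u) = ∫ r in Ioi (0 : ℝ), r⁻¹ • g r := by
  have hderiv : ∀ x ∈ (univ : Set ℝ), HasDerivWithinAt Real.exp (Real.exp x) univ x := fun x _ => (Real.hasDerivAt_exp x).hasDerivWithinAt
  have h := integral_image_eq_integral_abs_deriv_smul MeasurableSet.univ hderiv Real.exp_injective.injOn (fun r : ℝ => r⁻¹ • g r)
  rw [Set.image_univ, Real.range_exp, Measure.restrict_univ] at h
  rw [h]
  refine integral_congr_ae (Eventually.of_forall fun u => ?_)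
  show g (Real.exp u) = |Real.exp u| • ((Real.exp u)⁻¹ • g (Real.exp u))
  rw [abs_of_pos (Real.exp_pos u), smul_smul, mul_inv_cancel₀ (Real.exp_pos u).ne', one_smul]

/-- **`∫⁻_ℝ G(e^u) du = ∫⁻_0^∞ r⁻¹·G(r) dr`** (`ℝ≥0∞`; Mathlib `lintegral_image_eq_lintegral_abs_deriv_mul`). [cite: CasselsFrohlichANT1967, Ch. XV §4.3] -/
theorem lintegral_comp_exp_eq_setLIntegral (G : ℝ → ℝ≥0∞) : ∫⁻ u, G (Real.exp u) = ∫⁻ r in Ioi (0 : ℝ), ENNReal.ofReal r⁻¹ * G r := by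
  have hderiv : ∀ x ∈ (univ : Set ℝ), HasDerivWithinAt Real.exp (Real.exp x) univ x := fun x _ => (Real.hasDerivAt_exp x).hasDerivWithinAt
  have h := lintegral_image_eq_lintegral_abs_deriv_mul MeasurableSet.univ hderiv Real.exp_injective.injOn (fun r : ℝ => ENNReal.ofReal r⁻¹ * G r)
  rw [Set.image_univ, Real.range_exp, Measure.restrict_univ] at h
  rw [h]
  refine lintegral_congr fun u => ?_
  show G (Real.exp u) = ENNReal.ofReal |Real.exp u| * (ENNReal.ofReal (Real.exp u)⁻¹ * G (Real.exp u))
  rw [← mul_assoc, ← ENNReal.ofReal_mul (abs_nonneg _), abs_of_pos (Real.exp_pos u), mul_inv_cancel₀ (Real.exp_pos u).ne', ENNReal.ofReal_one, one_mul]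

end Real

/-! ## §2 Radial functions over a fundamental domain of `K^×` in `𝕀_K` -/

section IdeleClass

variable {K : Type} [Field K] [NumberField K]
variable [MeasurableSpace (GaloisRepresentations.ideleGroup K)] [BorelSpace (GaloisRepresentations.ideleGroup K)]
variable {E : Type*} [NormedAddCommGroup E] [NormedSpace ℝ E]

/-- **`∫_{𝓕} g(‖x‖) dν = V • ∫_0^∞ r⁻¹ • g(r) dr`** for a left-invariant `ν` finite on compacta, a fundamental domain `𝓕` of `K^×`, and `g` with `u ↦ g(e^u)` a.e.-strongly measurable
(`V = idelicCovolume K ν`): ★ `integral_comp_logNorm_eq` at `f := g ∘ exp` (`e^{log ‖x‖} = ‖x‖` ★ `exp_logNorm`) and §1. [cite: CasselsFrohlichANT1967, Ch. XV §4.3] -/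
theorem setIntegral_comp_ideleNorm_eq (ν : Measure (GaloisRepresentations.ideleGroup K)) [ν.IsMulLeftInvariant] [IsFiniteMeasureOnCompacts ν]
    {𝓕 : Set (GaloisRepresentations.ideleGroup K)} (h𝓕 : IsFundamentalDomain (GaloisRepresentations.principalIdeles K) 𝓕 ν)
    {g : ℝ → E} (hg : AEStronglyMeasurable (fun u : ℝ => g (Real.exp u)) volume) :
    ∫ x in 𝓕, g (IdeleClassGroup.ideleNorm K x : ℝ) ∂ν = (idelicCovolume K ν).toReal • ∫ r in Ioi (0 : ℝ), r⁻¹ • g r := by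
  have h := integral_comp_logNorm_eq ν h𝓕 (f := fun u : ℝ => g (Real.exp u)) hg
  simp only [exp_logNorm] at h
  rw [h, integral_comp_exp_eq_setIntegral_inv_smul]

/-- **`∫⁻_{𝓕} G(‖x‖) dν = V · ∫⁻_0^∞ r⁻¹·G(r) dr`** (`ℝ≥0∞` twin; `G` measurable). [cite: CasselsFrohlichANT1967, Ch. XV §4.3] -/
theorem setLIntegral_comp_ideleNorm_eq (ν : Measure (GaloisRepresentations.ideleGroup K)) [ν.IsMulLeftInvariant] [IsFiniteMeasureOnCompacts ν]
    {𝓕 : Set (GaloisRepresentations.ideleGroup K)} (h𝓕 : IsFundamentalDomain (GaloisRepresentations.principalIdeles K) 𝓕 ν)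
    {G : ℝ → ℝ≥0∞} (hG : Measurable G) :
    ∫⁻ x in 𝓕, G (IdeleClassGroup.ideleNorm K x : ℝ) ∂ν = idelicCovolume K ν * ∫⁻ r in Ioi (0 : ℝ), ENNReal.ofReal r⁻¹ * G r := by
  have h := lintegral_comp_logNorm_eq ν h𝓕 (f := fun u : ℝ => G (Real.exp u)) (hG.comp Real.measurable_exp)
  simp only [exp_logNorm] at h
  rw [h, lintegral_comp_exp_eq_setLIntegral]

end IdeleClass

/-! ## §3 HEAD: the `‖x‖⁻¹`-weighted radial integrand over an idele class domain — (δ)₂ ∕ Parseval-I currency -/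

section Weighted

variable {K : Type} [Field K] [NumberField K]
variable [MeasurableSpace (GaloisRepresentations.ideleGroup K)] [BorelSpace (GaloisRepresentations.ideleGroup K)]

/-- `r⁻¹ • (r⁻¹ • φ r) = φ r · r^{−2}` for `r > 0` (complex power with real positive base). [folklore] -/
theorem inv_smul_inv_smul_eq_mul_cpow_neg_two (φ : ℝ → ℂ) {r : ℝ} (hr : 0 < r) : r⁻¹ • (r⁻¹ • φ r) = φ r * (r : ℂ) ^ (-2 : ℂ) := by
  have hr0 : (r : ℂ) ≠ 0 := Complex.ofReal_ne_zero.2 hr.ne'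
  rw [smul_smul, Complex.real_smul, mul_comm, Complex.cpow_neg, show (2 : ℂ) = ((2 : ℕ) : ℂ) by norm_num, Complex.cpow_natCast]
  push_cast
  rw [pow_two, mul_inv]

/-- **HEAD — (GR): `∫_{𝓕} ‖x‖⁻¹ • φ(‖x‖) dν(x) = V • ∫_0^∞ φ(r)·r^{−2} dr`** for an idele class domain `𝓕` (★ `IsIdeleClassDomain`), a left-invariant `ν` finite on compacta (e.g. a Haar measure `ν_I`)
and `φ : ℝ → ℂ` with `u ↦ φ(e^u)` a.e.-strongly measurable; `V = idelicCovolume K ν` (`= κ`, the idelic bracket, by ★ Tate's formula).  Left side = the right side of ★ (δ)₂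
`exists_integral_weight_smul_eq_mul_setIntegral_ideleClass_two` for the RADIAL `Φ x = φ ‖x‖`; right side = the weight `r^{−2}` of ★ A's Parseval I. [cite: CasselsFrohlichANT1967, Ch. XV §4.3–4.4]
[cite: MoeglinWaldspurger1995, II.2.1] -/
theorem setIntegral_inv_ideleNorm_smul_comp_eq (ν : Measure (GaloisRepresentations.ideleGroup K)) [ν.IsMulLeftInvariant] [IsFiniteMeasureOnCompacts ν]
    {𝓕 : Set (GaloisRepresentations.ideleGroup K)} (h𝓕 : IsIdeleClassDomain K 𝓕)
    {φ : ℝ → ℂ} (hφ : AEStronglyMeasurable (fun u : ℝ => φ (Real.exp u)) volume) :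
    ∫ x in 𝓕, (IdeleClassGroup.ideleNorm K x : ℝ)⁻¹ • φ (IdeleClassGroup.ideleNorm K x : ℝ) ∂ν =
      (idelicCovolume K ν).toReal • ∫ r in Ioi (0 : ℝ), φ r * (r : ℂ) ^ (-2 : ℂ) := by
  have hg : AEStronglyMeasurable (fun u : ℝ => (Real.exp u)⁻¹ • φ (Real.exp u)) volume :=
    (Real.continuous_exp.inv₀ fun u => (Real.exp_pos u).ne').aestronglyMeasurable.smul hφ
  rw [setIntegral_comp_ideleNorm_eq ν (h𝓕.isFundamentalDomain ν) (g := fun r : ℝ => r⁻¹ • φ r) hg]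
  congr 1
  refine setIntegral_congr_fun measurableSet_Ioi fun r hr => ?_
  exact inv_smul_inv_smul_eq_mul_cpow_neg_two φ hr

/-- **`ℝ≥0∞` twin for (δ)₂'s majorant clause**: `∫⁻_{𝓕} ‖x‖⁻¹·Gm(‖x‖) dν = V · ∫⁻_0^∞ (r⁻¹·r⁻¹)·Gm(r) dr` (`Gm : ℝ → ℝ≥0∞` measurable) — so `∫⁻_{𝓕} ‖x‖⁻¹ Φm dν_I < ∞` for a radial
majorant `Φm x = Gm ‖x‖` reduces to a one-variable integral. [cite: CasselsFrohlichANT1967, Ch. XV §4.3] -/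
theorem setLIntegral_inv_ideleNorm_mul_comp_eq (ν : Measure (GaloisRepresentations.ideleGroup K)) [ν.IsMulLeftInvariant] [IsFiniteMeasureOnCompacts ν]
    {𝓕 : Set (GaloisRepresentations.ideleGroup K)} (h𝓕 : IsIdeleClassDomain K 𝓕)
    {Gm : ℝ → ℝ≥0∞} (hGm : Measurable Gm) :
    ∫⁻ x in 𝓕, (((IdeleClassGroup.ideleNorm K x)⁻¹ : ℝ≥0) : ℝ≥0∞) * Gm (IdeleClassGroup.ideleNorm K x : ℝ) ∂ν =
      idelicCovolume K ν * ∫⁻ r in Ioi (0 : ℝ), ENNReal.ofReal (r⁻¹ * r⁻¹) * Gm r := by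
  have hG : Measurable fun r : ℝ => ENNReal.ofReal r⁻¹ * Gm r := (ENNReal.measurable_ofReal.comp measurable_inv).mul hGm
  have h := setLIntegral_comp_ideleNorm_eq ν (h𝓕.isFundamentalDomain ν) hG
  have hlhs : (fun x : GaloisRepresentations.ideleGroup K => (((IdeleClassGroup.ideleNorm K x)⁻¹ : ℝ≥0) : ℝ≥0∞) * Gm (IdeleClassGroup.ideleNorm K x : ℝ)) =
      fun x => ENNReal.ofReal ((IdeleClassGroup.ideleNorm K x : ℝ))⁻¹ * Gm (IdeleClassGroup.ideleNorm K x : ℝ) := by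
    funext x
    rw [← NNReal.coe_inv, ENNReal.ofReal_coe_nnreal]
  rw [hlhs, h]
  congr 1
  refine setLIntegral_congr_fun measurableSet_Ioi fun r hr => ?_
  rw [← mul_assoc, ← ENNReal.ofReal_mul (inv_nonneg.2 (le_of_lt hr))]

end Weighted

end Summit.HodgeConjecture.HodgeConjecture.Cruxes.H413.K2E1IdeleClassRadialIntegralCM

end
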